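import Summits.CriticalPhenomena.PercolationContinuityZ3.Theorems.PercNearOneGluingNoHeavyLowerTailRKNS3
import Summits.CriticalPhenomena.PercolationContinuityZ3.Theorems.PercNearOneGluingNoHeavyLowerTailNearOneConvexGluing
import HarnessLib

/-!
# `NoHeavyLowerTail` (stmt-CriticalPhenomena-4575) — the fully-refined row `(RKNS³)_k` is only needed in the NEAR-ONE regime

Support file (seat `prim-ineq-gen-7`, `--supports stmt-CriticalPhenomena-4575`). No definitions, no sorries.

`noHeavyLowerTail_of_rkns3` (this seat, `…RKNS3`) asks for the row on EVERY instance.  Composing instead with the landed regime bridge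
`NearOneConvexGluing.nearOneGluing_of_eventGluingNearOne` (event gluing with any constant is only needed when `μ(o↔A) ≥ 1−δ₀`, all pairs
`μ(a↔a') ≥ 1−δ₀`, all `μ(a↮c) ≤ δ₀`) and the landed converse chain `NearOneGluing ⟹ ManyFingersLargePocket ⟹ NoHeavyLowerTail` gives
`noHeavyLowerTail_of_rkns3_nearOne`: **for any fixed `δ₀ > 0`, the row `(RKNS³)_k ≥ 0` on the near-one instances alone closes the crux.**
(The regime hypothesis on `o` is stated as `1 − δ₀ ≤ μ(o ↔ A ∪ {c})`, which is what survives the passage to the relay set `A ∖ {c}`.)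
Seat census (run/shared/lean/prim/prim-ineq-gen-7/FINDING-RKNSK.md §6): in the δ₀ = 0.3 regime the row keeps ≥ 90 % of the event-gluing margin at
every k tested (k ≤ 40), with no degradation in k; outside the regime its infimum ratio tends to 0⁺ along o-stars.
[cite: KozmaNitzan2024, Conjecture 3 (p. 15), Theorem 2 (pp. 8–9); VandenbergHaggstromKahn2005, Thms. 1.3–1.4 (pp. 6–7)]
-/

namespace Summit.CriticalPhenomena.PercolationContinuityZ3.Theorems

open MeasureTheory Set Literature.Probability.LatticeModels Literature.Probability.Percolation

noncomputable section
open Classical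

variable {n : ℕ}

/-- **`(RKNS³)` on near-one instances ⟹ `NoHeavyLowerTail`.**  Fix `δ₀ > 0`.  Suppose the fully-refined residual row (notation of
`…NoHeavyLowerTailRKNS3`) is nonnegative for all `n, w`, relay sets `A`, `o ∉ A`, `c ∉ A`, `o ≠ c`, worst `z ∈ A`, WHENEVER
`1 − δ₀ ≤ μ(o ↔ A ∪ {c})`, `1 − δ₀ ≤ μ(a ↔ a')` for all `a, a' ∈ A` and `μ(a ↮ c) ≤ δ₀` for all `a ∈ A`.  Then `NoHeavyLowerTail`. [this file] -/
theorem noHeavyLowerTail_of_rkns3_nearOne (δ₀ : ℝ) (hδ₀ : 0 < δ₀)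
    (hR : ∀ (n : ℕ) (w : Sym2 (Fin n) → unitInterval) (A : Finset (Fin n)) (o c z : Fin n),
      o ∉ A → c ∉ A → o ≠ c → z ∈ A →
      (∀ a ∈ A, (prodBernoulli w).real (openConn z c) ≤ (prodBernoulli w).real (openConn a c)) →
      1 - δ₀ ≤ (prodBernoulli w).real (⋃ a ∈ insert c A, (openConn o a : Set (BondConfig (Fin n)))) →
      (∀ a ∈ A, ∀ a' ∈ A, 1 - δ₀ ≤ (prodBernoulli w).real (openConn a a' : Set (BondConfig (Fin n)))) →
      (∀ a ∈ A, (prodBernoulli w).real (openConn a c : Set (BondConfig (Fin n)))ᶜ ≤ δ₀) →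
      0 ≤ ∑ S ∈ (A.erase z).powerset.filter (fun S => S.Nonempty),
        ((prodBernoulli w).real
            ({ω : BondConfig (Fin n) | ∀ s ∈ insert c (insert o S), ∀ x ∈ A \ S, ¬ (openGraph ω).Reachable s x} ∩
              ⋃ s ∈ insert c S, (openConn s o : Set (BondConfig (Fin n)))) /
          (prodBernoulli w).real {ω : BondConfig (Fin n) | ∀ s ∈ insert c (insert o S), ∀ x ∈ A \ S, ¬ (openGraph ω).Reachable s x} *
          (prodBernoulli w).real
              ({ω : BondConfig (Fin n) | ∀ s ∈ insert o S, ∀ x ∈ A \ S, ¬ (openGraph ω).Reachable s x} ∩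
                ⋂ s ∈ S, (openConn s c : Set (BondConfig (Fin n)))) -
        (prodBernoulli w).real
            ({ω : BondConfig (Fin n) | ∀ s ∈ insert o S, ∀ x ∈ insert c (A \ S), ¬ (openGraph ω).Reachable s x} ∩
              ⋃ s ∈ S, (openConn s o : Set (BondConfig (Fin n)))) /
          (prodBernoulli w).real {ω : BondConfig (Fin n) | ∀ s ∈ insert o S, ∀ x ∈ insert c (A \ S), ¬ (openGraph ω).Reachable s x} *
          (prodBernoulli w).real
              ({ω : BondConfig (Fin n) | ∀ s ∈ insert o S, ∀ x ∈ A \ S, ¬ (openGraph ω).Reachable s x} ∩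
                ⋂ x ∈ A \ S, (openConn x c : Set (BondConfig (Fin n))))) +
        (prodBernoulli w).real ((⋃ a ∈ A, (openConn o a : Set (BondConfig (Fin n))))ᶜ ∩ (openConn z c)ᶜ)) :
    Summit.CriticalPhenomena.PercolationContinuityZ3.Theses.PercNearOneGluing.NoHeavyLowerTail := by
  refine noHeavyLowerTail_of_manyFingersLargePocket
    (manyFingersLargePocket_of_nearOneGluing
      (NearOneConvexGluing.nearOneGluing_of_eventGluingNearOne 1 δ₀ zero_le_one hδ₀ ?_))
  intro n w A o c s hs hsδ hregA hregP hcut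
  rw [one_mul]
  by_cases hoc : o = c
  · subst hoc
    have hempty : ((openConn o o : Set (BondConfig (Fin n)))ᶜ ∩ ⋃ a ∈ A, openConn o a) = ∅ := by
      ext ω
      simp only [mem_inter_iff, mem_compl_iff, mem_empty_iff_false, iff_false, not_and]
      intro h; exact absurd (show ω ∈ (openConn o o : Set (BondConfig (Fin _))) from SimpleGraph.Reachable.refl o) h
    rw [hempty, measureReal_empty]; exact hs
  by_cases hoA : o ∈ A
  · calc (prodBernoulli w).real ((openConn o c : Set (BondConfig (Fin n)))ᶜ ∩ ⋃ a ∈ A, openConn o a)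
        ≤ (prodBernoulli w).real ((openConn o c : Set (BondConfig (Fin n)))ᶜ) :=
          measureReal_mono (h₂ := measure_ne_top _ _) inter_subset_left
      _ ≤ s := hcut o hoA
  set A' : Finset (Fin n) := A.erase c with hA'
  have hAsub : A ⊆ insert c A' := by
    intro x hx
    by_cases hxc : x = c
    · subst hxc; exact Finset.mem_insert_self _ _
    · exact Finset.mem_insert_of_mem (by rw [hA', Finset.mem_erase]; exact ⟨hxc, hx⟩)
  have hsub : ((openConn o c : Set (BondConfig (Fin n)))ᶜ ∩ ⋃ a ∈ A, openConn o a) ⊆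
      (⋃ a ∈ A', (openConn o a : Set (BondConfig (Fin n)))) \ openConn o c := by
    rintro ω ⟨hoc', hU⟩
    simp only [mem_iUnion, exists_prop] at hU
    obtain ⟨a, haA, hoa⟩ := hU
    refine ⟨?_, hoc'⟩
    simp only [mem_iUnion, exists_prop]
    refine ⟨a, ?_, hoa⟩
    rw [hA', Finset.mem_erase]
    refine ⟨?_, haA⟩
    rintro rfl; exact hoc' hoa
  refine (measureReal_mono (h₂ := measure_ne_top _ _) hsub).trans ?_
  by_cases hne : A'.Nonempty
  swap
  · rw [Finset.not_nonempty_iff_eq_empty] at hne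
    have hempty : ((⋃ a ∈ A', (openConn o a : Set (BondConfig (Fin n)))) \ openConn o c) = ∅ := by
      rw [hne]; simp
    rw [hempty, measureReal_empty]; exact hs
  obtain ⟨z, hzA', hzmin⟩ := Finset.exists_min_image A' (fun a => (prodBernoulli w).real (openConn a c)) hne
  have hoA' : o ∉ A' := fun h => hoA (Finset.mem_of_mem_erase h)
  have hcA' : c ∉ A' := by rw [hA']; exact Finset.notMem_erase c A
  -- the near-one hypotheses survive the passage to `A' = A ∖ {c}`
  have hregA' : 1 - δ₀ ≤ (prodBernoulli w).real (⋃ a ∈ insert c A', (openConn o a : Set (BondConfig (Fin n)))) :=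
    hregA.trans (measureReal_mono (h₂ := measure_ne_top _ _) (Set.biUnion_subset_biUnion_left fun a ha => hAsub ha))
  have hregP' : ∀ a ∈ A', ∀ a' ∈ A', 1 - δ₀ ≤ (prodBernoulli w).real (openConn a a' : Set (BondConfig (Fin n))) :=
    fun a ha a' ha' => hregP a (Finset.mem_of_mem_erase ha) a' (Finset.mem_of_mem_erase ha')
  have hcut' : ∀ a ∈ A', (prodBernoulli w).real (openConn a c : Set (BondConfig (Fin n)))ᶜ ≤ δ₀ :=
    fun a ha => (hcut a (Finset.mem_of_mem_erase ha)).trans hsδ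
  have hEG := eventGluing_of_rkns3_at w A' o c z hoA' hcA' hoc hzA'
    (hR n w A' o c z hoA' hcA' hoc hzA' hzmin hregA' hregP' hcut')
  exact hEG.trans (hcut z (Finset.mem_of_mem_erase hzA'))

end

end Summit.CriticalPhenomena.PercolationContinuityZ3.Theorems
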